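/-
Copyright (c) 2026 the pub-hodgecm-mathlib formalisation cell (harness21).  Prover seat hodgecm-mathlib-K2E3-p05 (g3), Track B «K2-LIT», engine E3, unit U4 «Keys»; PLACE-FREE LAYER
(`hd ↦ hϖ`) of ★ p856662 `K2E3IwahoriScalarExplicit` §2 + the module of a uniformiser at ANY non-split place; 2026-09-04.  KERNEL module: THEOREMS ONLY.
-/
import Summits.HodgeConjecture.HodgeConjecture.Theorems.K2E3IwahoriScalarExplicit       -- ★ p856662 (this seat): `card_eq_index_of_isLeftTransversal` (hd-free) and the unramified §2∕§3; brings ★ II-1 letters, ★ BorelTorusModulus, ★ residue-card dictionaries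
import HarnessLib

/-!
# K2 ∕ E3 «EllipticInputs», unit U4 «Keys» — Road II′ (TAME RAMIFIED places), PLACE-FREE LAYER «THE EXPLICIT `K₁`-SCALAR» over the uniformiser token `hϖ`, and
# `‖ϖ_E‖ = N(w)⁻¹` for a uniformiser unit of `E_v` at ANY non-split place `v` (`N(w) = |𝓞_L ∕ 𝔭_w|`)   [BruhatTits1972 (4.4.3); Casselman1980 §3; WeilBNT1967 I §4]

Cell hodgecm-mathlib (D-0151), FLOOR 0, Track B «K2-LIT», engine E3, crux item H413 = stmt-HodgeConjecture-24833 (route `HCCMUnconditional`, no route verbs); target BY NAME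
`…K2E3EllipticInputs.U4Keys.sig_K2E3KeysThmTwoContracting` (U4-f), residue (R1) «ramified places» of MEMO v4 (Road II′).  Author K2E3-p05 (g3).  `--supports stmt-HodgeConjecture-24833
--as helper`; THEOREMS ONLY.  §1 = ★ p856662 `exists_borel_mul_weyl_mem_K1_explicit` with `hd` replaced by `hϖ : |ϖ|_w = exp(−1)` (it reads `hd` only through `hd.σσ`, `hd.vσ`, `hd.vϖ`;
place-free ★ `galAdicCompletionMap_galAdicCompletionMap_of_smul_eq`, ★ `valued_galAdicCompletionMap`), proof VERBATIM: a Borel `d` with `d·w̃ ∈ K₁`, `(proj d)₀₀ = a`, `a_w = ϖ⁻¹`,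
`a⁻¹` a uniformiser unit, `δ_B^{1∕2}(d) = ‖a‖` — at EVERY non-split `v`.  §2: for every uniformiser unit `ϖ_E` of `E_v = Π_{w∣v} L_w` (one factor) at a non-split `v`,
`‖ϖ_E‖ = N(w)⁻¹` with `N(w) = |𝓞_L ∕ 𝔭_w|` (★ `unitModulusChar_localRing_eq_prod`, ★ `normAbs_eq_inv_of_valued_eq_exp_neg_one`, ★ `residueFieldCard_adicCompletion_eq`) — no
hypothesis on the ramification of `v` (at an inert place `N(w) = q_v²`, ★ p856662 §3; at a ramified place `N(w) = q_v`).
HONEST LABEL: HC_CM is proved only modulo the 7 printed citations (2 remaining named inputs: hLiu418 = stmt-HodgeConjecture-24832, h413 = stmt-HodgeConjecture-24833)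
until rung 0 closes; count-neutral (place-free twin + dictionary; no printed citation is discharged).

## References
* [BruhatTits1972] F. Bruhat, J. Tits, Publ. Math. IHÉS 41 (1972), (4.4.3).  * [Casselman1980] W. Casselman, Compositio Math. 40 (1980), §3.
* [WeilBNT1967] A. Weil, *Basic Number Theory* (1967), Ch. I §4 (`mod(ϖ) = q⁻¹`).  * [NeukirchANT1999] J. Neukirch, *Algebraic Number Theory* (1999), Ch. II Prop. (4.3).
-/

set_option autoImplicit false
-- the mandated namespace has the single-problem summit's repeated segment (`HodgeConjecture.HodgeConjecture`)
set_option linter.dupNamespace false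

noncomputable section

open NumberField IsDedekindDomain MeasureTheory
open scoped Matrix MatrixGroups NNReal WithZero Valued
open Literature.NumberTheory Literature.NumberTheory.Automorphic Literature.NumberTheory.Automorphic.UnitaryGroup
open Literature.NumberTheory.Rogawski1990 Literature.NumberTheory.GaloisRepresentations
open Literature.NumberTheory.GaloisRepresentations.IsNonarchimedeanLocalField

namespace Summit.HodgeConjecture.HodgeConjecture.Cruxes.H413.K2E3IwahoriScalarExplicitPF

open Summit.HodgeConjecture.HodgeConjecture.Cruxes.H413
open Summit.HodgeConjecture.HodgeConjecture.Cruxes.H413.F0P3cStCharTSStLevelsTransport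

variable (L : Type) [Field L] [NumberField L] [IsCMField L] (v : HeightOneSpectrum (𝓞 ↥(maximalRealSubfield L)))
  (w : PlacesOver L v) (hw : IsCMField.complexConj L • w.1 = w.1)
  (eA : Gqs L v ≃ₜ* ↥(unitaryGroupOfForm (galAdicCompletionMap (L := L) (IsCMField.complexConj L) hw) ((StdForm.antidiagonal 3).over (w.1.adicCompletion L))))
  (heA : ∀ g : Gqs L v,
    ((eA g : ↥(unitaryGroupOfForm (galAdicCompletionMap (L := L) (IsCMField.complexConj L) hw) ((StdForm.antidiagonal 3).over (w.1.adicCompletion L)))) : GL (Fin 3) (w.1.adicCompletion L)) =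
      ((localNonsplitEquiv (IsCMField.complexConj L) (qsForm L) (IsCMField.complexConj_ne_one L) w hw g :
        ↥(unitaryGroupOfForm (galAdicCompletionMap (L := L) (IsCMField.complexConj L) hw) (placeForm (qsForm L) w.1))) : GL (Fin 3) (w.1.adicCompletion L)))

/-! ## §1 The explicit Borel `d` with `d·w̃ ∈ K₁` over the uniformiser token -/

include heA in
set_option maxHeartbeats 3200000 in
set_option synthInstance.maxHeartbeats 400000 in
-- instance-path unification between `Gqs L v` and the matrix carrier of ★ `cmBorelTriple` (class of ★ II-1 §4)
/-- **THE EXPLICIT `d` (place-free).**  There is a Borel `d ∈ B_v` with `d·w̃ ∈ K₁` (`w̃ = eA⁻¹w`; the binder `d hdK1` of ★ II-1 `add_smul_mem_fixedPoints_K1` ∕ ★ II-2b `avgProj_K1_eq`)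
such that, writing `a := (proj d)₀₀ ∈ E_vˣ`: `a_w = ϖ⁻¹`, `a⁻¹` is a uniformiser unit of `E_v` (`|a⁻¹_{w′}|_{w′} = exp(−1)` at every `w′ ∣ v`), and `δ_B^{1∕2}(d) = ‖a‖`.
(`d = eA⁻¹ diag(ϖ⁻¹, 1, ϖ)`, ★ `exists_mem_torusU_coe_eq_mul_weylLongU_mem_conj_glInt`; ★ `coe_torusEntry_proj_borelTriple`, ★ `coe_eA_apply`, ★ `rootDeltaChar_cmBorel_eq_unitModulusChar`.)
[cite: BruhatTits1972, (4.4.3)] [cite: Casselman1980, §3] [cite: Rogawski1990, §12.1 p. 171] -/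
theorem exists_borel_mul_weyl_mem_K1_explicit {ϖ : w.1.adicCompletion L}
    (hϖ : Valued.v ϖ = WithZero.exp (-1 : ℤ))
    (g₁ : GL (Fin 3) (w.1.adicCompletion L)) (hg₁ : (g₁ : Matrix (Fin 3) (Fin 3) (w.1.adicCompletion L)) = Matrix.diagonal ![(1 : w.1.adicCompletion L), 1, ϖ])
    (K1 : Subgroup (Gqs L v))
    (hK1 : K1 = (((glInt 3 (w.1.adicCompletion L)).map (MulAut.conj g₁).toMonoidHom).subgroupOf
      (unitaryGroupOfForm (galAdicCompletionMap (L := L) (IsCMField.complexConj L) hw) ((StdForm.antidiagonal 3).over (w.1.adicCompletion L)))).comap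
        eA.toMulEquiv.toMonoidHom) :
    ∃ d : ↥(cmBorelTriple L 3 v).P,
      (d : ↥(unitaryGroupOfForm (conjLocal L (IsCMField.complexConj L) v) (cmLocalForm L 3 v))) *
          (![(1 : ↥(unitaryGroupOfForm (conjLocal L (IsCMField.complexConj L) v) (cmLocalForm L 3 v))),
            eA.symm (weylLongU (galAdicCompletionMap (L := L) (IsCMField.complexConj L) hw) (rfl : (StdForm.antidiagonal 3).over (w.1.adicCompletion L) = _))] 1) ∈ K1 ∧
      ((torusEntry (conjLocal L (IsCMField.complexConj L) v) (cmLocalForm L 3 v) 0 ((cmBorelTriple L 3 v).proj d) : (LocalRing L v)ˣ) : LocalRing L v) w = ϖ⁻¹ ∧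
      (∀ w' : PlacesOver L v, Valued.v ((((torusEntry (conjLocal L (IsCMField.complexConj L) v) (cmLocalForm L 3 v) 0 ((cmBorelTriple L 3 v).proj d))⁻¹ :
          (LocalRing L v)ˣ) : LocalRing L v) w') = WithZero.exp (-1 : ℤ)) ∧
      (haveI := locallyCompactSpace_cmBorelU L 3 v; ((rootDeltaChar (cmBorelTriple L 3 v).P d : ℂˣ) : ℂ)) =
        ((unitModulusChar (LocalRing L v) (torusEntry (conjLocal L (IsCMField.complexConj L) v) (cmLocalForm L 3 v) 0 ((cmBorelTriple L 3 v).proj d)) : ℝ≥0) : ℝ) := by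
  haveI : Subsingleton (PlacesOver L v) := PlacesOver.subsingleton_of_smul_eq (IsCMField.complexConj L) (IsCMField.complexConj_ne_one L) w hw
  obtain ⟨dm, hdT, hdmat, hdw⟩ := exists_mem_torusU_coe_eq_mul_weylLongU_mem_conj_glInt (galAdicCompletionMap (L := L) (IsCMField.complexConj L) hw)
    (rfl : (StdForm.antidiagonal 3).over (w.1.adicCompletion L) = _) (galAdicCompletionMap_galAdicCompletionMap_of_smul_eq (IsCMField.complexConj L) w (IsCMField.complexConj_ne_one L) hw) (fun a => valued_galAdicCompletionMap (L := L) (IsCMField.complexConj L) hw a) hϖ g₁ hg₁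
  set d : ↥(cmBorelTriple L 3 v).P := ⟨eA.symm dm, eA_symm_mem_borel L v w hw eA heA (torusU_le_borelU _ _ hdT)⟩ with hddef
  -- the first diagonal entry of `d` at `w` is that of `dm = eA d`, i.e. `ϖ⁻¹`
  have hentry : ((torusEntry (conjLocal L (IsCMField.complexConj L) v) (cmLocalForm L 3 v) 0 ((cmBorelTriple L 3 v).proj d) : (LocalRing L v)ˣ) : LocalRing L v) w = ϖ⁻¹ := by
    rw [coe_torusEntry_proj_borelTriple]
    have h := coe_eA_apply L v w hw eA heA (eA.symm dm) 0 0
    rw [ContinuousMulEquiv.apply_symm_apply, hdmat] at h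
    have h00 : (!![ϖ⁻¹, 0, 0; 0, 1, 0; 0, 0, galAdicCompletionMap (L := L) (IsCMField.complexConj L) hw ϖ] : Matrix (Fin 3) (Fin 3) (w.1.adicCompletion L)) 0 0 = ϖ⁻¹ := rfl
    rw [h00] at h
    exact h.symm
  refine ⟨d, ?_, hentry, fun w' => ?_, ?_⟩
  · -- `d·w̃ ∈ K1`: `eA (d w̃) = dm·w ∈ g₁GL₃(𝒪)g₁⁻¹`
    subst hK1
    let eU : ↥(unitaryGroupOfForm (conjLocal L (IsCMField.complexConj L) v) (cmLocalForm L 3 v)) ≃ₜ* ↥(unitaryGroupOfForm (galAdicCompletionMap (L := L) (IsCMField.complexConj L) hw) ((StdForm.antidiagonal 3).over (w.1.adicCompletion L))) := eA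
    have hmem : eU (eU.symm dm * (![(1 : ↥(unitaryGroupOfForm (conjLocal L (IsCMField.complexConj L) v) (cmLocalForm L 3 v))), eA.symm (weylLongU (galAdicCompletionMap (L := L) (IsCMField.complexConj L) hw) (rfl : (StdForm.antidiagonal 3).over (w.1.adicCompletion L) = _))] 1)) ∈
        ((glInt 3 (w.1.adicCompletion L)).map (MulAut.conj g₁).toMonoidHom).subgroupOf
          (unitaryGroupOfForm (galAdicCompletionMap (L := L) (IsCMField.complexConj L) hw) ((StdForm.antidiagonal 3).over (w.1.adicCompletion L))) := by
      rw [map_mul, ContinuousMulEquiv.apply_symm_apply, eA_vec L v w hw eA 1]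
      exact hdw
    exact (mem_comap_iff L v w hw eA _ _).2 hmem
  · -- `a⁻¹` is a uniformiser unit (one place above `v`)
    obtain rfl : w' = w := Subsingleton.elim _ _
    rw [Units.val_inv_eq_inv_val, Pi.inv_apply, hentry, inv_inv]
    exact hϖ
  · -- `δ_B^{1∕2}(d) = ‖d₀₀‖ = ‖(proj d)₀₀‖`
    rw [F0P2oBorelTorusModulus.rootDeltaChar_cmBorel_eq_unitModulusChar L v d]
    congr 3
    apply Units.ext
    rw [coe_diagEntry, coe_torusEntry_proj_borelTriple]

/-! ## §2 `‖ϖ_E‖ = N(w)⁻¹` for a uniformiser unit of `E_v` at any non-split place -/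

/-- **`‖ϖ_E‖ = N(w)⁻¹`** at a non-split place `v`: every uniformiser unit `ϖ_E` of `E_v = Π_{w∣v} L_w` (one factor) has module `N(w)⁻¹`, `N(w) = |𝓞_L ∕ 𝔭_w|` — no hypothesis on the
ramification of `v` (`‖u‖ = Π_w |u_w|_w` ★, `|ϖ|_w = q_w⁻¹` ★, `q_w = N(w)` ★). [cite: WeilBNT1967, Ch. I §4] [cite: NeukirchANT1999, Ch. II Prop. (4.3)] -/
theorem unitModulusChar_uniformizer_eq_inv_card (hns : ∀ w' : PlacesOver L v, IsCMField.complexConj L • w'.1 = w'.1)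
    (ϖE : (LocalRing L v)ˣ) (hϖE : ∀ w' : PlacesOver L v, Valued.v ((ϖE : LocalRing L v) w') = WithZero.exp (-1 : ℤ)) :
    unitModulusChar (LocalRing L v) ϖE = ((Nat.card (𝓞 L ⧸ w.1.asIdeal) : ℕ) : ℝ≥0)⁻¹ := by
  haveI : Subsingleton (PlacesOver L v) := PlacesOver.subsingleton_of_smul_eq (IsCMField.complexConj L) (IsCMField.complexConj_ne_one L) w (hns w)
  rw [unitModulusChar_localRing_eq_prod, Fintype.prod_subsingleton _ w, normAbs_eq_inv_of_valued_eq_exp_neg_one w.1 (hϖE w),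
    residueFieldCard_adicCompletion_eq, IsDedekindDomain.HeightOneSpectrum.residueCard_eq_card_quotient]

/-- The same as a complex number: `‖ϖ_E‖ = N(w)⁻¹` in `ℂ`. [cite: WeilBNT1967, Ch. I §4] -/
theorem coe_unitModulusChar_uniformizer_eq_inv_card (hns : ∀ w' : PlacesOver L v, IsCMField.complexConj L • w'.1 = w'.1)
    (ϖE : (LocalRing L v)ˣ) (hϖE : ∀ w' : PlacesOver L v, Valued.v ((ϖE : LocalRing L v) w') = WithZero.exp (-1 : ℤ)) :
    (((unitModulusChar (LocalRing L v) ϖE : ℝ≥0) : ℝ) : ℂ) = ((Nat.card (𝓞 L ⧸ w.1.asIdeal) : ℂ))⁻¹ := by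
  rw [unitModulusChar_uniformizer_eq_inv_card L v w hns ϖE hϖE, NNReal.coe_inv, Complex.ofReal_inv, NNReal.coe_natCast, Complex.ofReal_natCast]

end Summit.HodgeConjecture.HodgeConjecture.Cruxes.H413.K2E3IwahoriScalarExplicitPF

end
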